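import Summits.ResolutionOfSingularities.ResolutionOfSingularities.Theorems.ContactShadowClasses
import Summits.ResolutionOfSingularities.ResolutionOfSingularities.Theorems.SurfaceShadowKernels

/-!
# ContactShadowKernels — the PROVED kernels of node N59 `ContactShadow` (decomp-res lens-4 g12)

Companion of `Theorems.ContactShadowClasses` (vocabulary, pieces, ports, paper proofs).  Contents: the column logic
(`noTower_iff_columns`: EXACT split of a tower class into its PERFECT and IMPERFECT ground-field columns), the shadow-class
logic (`noShadowTower_mono/_split`, `shadow_iff_pieces`: EXACT four-way split by hug type, `shadowImp_of_pieces`), the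
`≥ N` corner-tower bookkeeping (`cornerTowerGEOfCornerTower`, `noCornerTower_of_ge`, sanity `noCornerTowerGE_zero/one`,
`noCornerTowerGE_of_model`), the three DECIDED shadow pieces from their ports (`shadowTransversal_of_ports/_of_model`,
`shadowCurve_of_law` — Lean end `HugDimensionClasses.noInfiniteDescent` —, `shadowContact_of_law` — Lean end
`SurfaceShadowKernels.noCornerDescent`), the columns from the formal shadow (`contact_of_formal`,
`contactImperfect_of_formal/_of_ports`, `contact_iff_columns`) and the sanity kernels `towerObstructs_of_all`,
`noCornerTower_of_modelGE`.  Theses-free; the by-name wiring to the `MaxContactCut` items (perfect column via X1, 31571,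
up-links) is `Theorems.MaxContactCutContactShadow`.  All proofs are pure logic over the stated ports (`[folklore]`).  0 `sorry`.
-/

open CategoryTheory AlgebraicGeometry
open Literature.AlgebraicGeometry.Resolution
open Summit.ResolutionOfSingularities.ResolutionOfSingularities.Theorems
open WeakOrderReduction ForcedTowerClasses DivergentTowerClasses MonomialTowerClasses HugDimensionClasses HugDimensionKernels
open ContactShadowClasses

namespace Summit.ResolutionOfSingularities.ResolutionOfSingularities.Theorems.ContactShadowKernels

/-! ## §2 Column and shadow-class logic -/

/-- pure logic. [folklore] -/
theorem noTowerImperfect_of_noTower {n : ℕ} {P : ForcedTower → Prop} (h : NoTower n P) : NoTowerImperfect n P :=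
  fun p hp k _ _ _ T g hB hD hE hP => h p hp k T g hB hD hE hP

/-- pure logic. [folklore] -/
theorem noTowerImperfect_mono {n : ℕ} {P Q : ForcedTower → Prop} (hPQ : ∀ T, Q T → P T)
    (h : NoTowerImperfect n P) : NoTowerImperfect n Q :=
  fun p hp k _ _ hk T g hB hD hE hQ => h p hp k hk T g hB hD hE (hPQ T hQ)

/-- **EXACT column split** (excluded middle on `PerfectField k`). [folklore] -/
theorem noTower_iff_columns {n : ℕ} (P : ForcedTower → Prop) :
    NoTower n P ↔ NoTowerPerfect n P ∧ NoTowerImperfect n P := by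
  refine ⟨fun h => ⟨noTowerPerfect_of_noTower h, noTowerImperfect_of_noTower h⟩, ?_⟩
  rintro ⟨h₁, h₂⟩ p hp k _ _ T g hB hD hE hP
  by_cases hk : PerfectField k
  · exact h₁ p hp k T g hB hD hE hP
  · exact h₂ p hp k hk T g hB hD hE hP

/-- pure logic. [folklore] -/
theorem noShadowTower_mono {N : ℕ} {P Q : ForcedTower → Prop} (hPQ : ∀ T, Q T → P T) (h : NoShadowTower N P) :
    NoShadowTower N Q :=
  fun p hp A _ _ _ hA hd T hT hQ => h p hp A hA hd T hT (hPQ T hQ)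

/-- pure logic. [folklore] -/
theorem noShadowTowerImp_of_noShadowTower {N : ℕ} {P : ForcedTower → Prop} (h : NoShadowTower N P) :
    NoShadowTowerImp N P :=
  fun p hp A _ _ _ hA hd _ T hT hP => h p hp A hA hd T hT hP

/-- pure logic. [folklore] -/
theorem noShadowTowerImp_mono {N : ℕ} {P Q : ForcedTower → Prop} (hPQ : ∀ T, Q T → P T)
    (h : NoShadowTowerImp N P) : NoShadowTowerImp N Q :=
  fun p hp A _ _ _ hA hd hK T hT hQ => h p hp A hA hd hK T hT (hPQ T hQ)

/-- EXACT bisection of a shadow class by any predicate (excluded middle). [folklore] -/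
theorem noShadowTower_split {N : ℕ} (P Q : ForcedTower → Prop) :
    NoShadowTower N P ↔ NoShadowTower N (fun T => P T ∧ Q T) ∧ NoShadowTower N (fun T => P T ∧ ¬ Q T) := by
  refine ⟨fun h => ⟨noShadowTower_mono (fun _ h' => h'.1) h, noShadowTower_mono (fun _ h' => h'.1) h⟩, ?_⟩
  rintro ⟨h₁, h₂⟩ p hp A _ _ _ hA hd T hT hP
  by_cases hQ : Q T
  · exact h₁ p hp A hA hd T hT ⟨hP, hQ⟩
  · exact h₂ p hp A hA hd T hT ⟨hP, hQ⟩

/-! ### The combinatorial normal form of a transversal shadow tower (order `≥ N`, not `= N`) -/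

/-- The tree's exact-order corner towers are corner towers of order `≥ n`. [folklore] -/
def cornerTowerGEOfCornerTower {d n : ℕ} (c : CornerTower d n) : CornerTowerGE d n where
  G := c.G
  dir := c.dir
  nonempty i := by
    obtain ⟨⟨α, hα, -⟩, -⟩ := c.hasOrder i
    exact ⟨α, hα⟩
  orderGE i := (c.hasOrder i).2
  isolated := c.isolated
  step := c.step

/-- The `≥ N` leaf refines the tree's leaf `NoCornerTower`. [folklore] -/
theorem noCornerTower_of_ge {d n : ℕ} (h : NoCornerTowerGE d n) : NoCornerTower d n :=
  fun c => h (cornerTowerGEOfCornerTower c)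

/-- Sanity (`d = 0`): no corner tower in zero parameters when `N ≥ 1`. [folklore] -/
theorem noCornerTowerGE_zero {N : ℕ} (hN : 1 ≤ N) : NoCornerTowerGE 0 N := by
  intro c
  obtain ⟨α, hα⟩ := c.nonempty 0
  have h := c.orderGE 0 α hα
  have hdeg : α.deg = 0 := by simp [Expo.deg]
  omega

/-- Sanity (`d = 1`): in one parameter every chart step lowers every degree by `N ≥ 1`. [folklore] -/
theorem noCornerTowerGE_one {N : ℕ} (hN : 1 ≤ N) : NoCornerTowerGE 1 N := by
  intro c
  have hdeg1 : ∀ (α : Expo 1) (j : Fin 1), α.deg - α j = 0 := by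
    intro α j
    have hj : j = 0 := Subsingleton.elim _ _
    subst hj
    simp [Expo.deg]
  -- every degree at stage `i` is at most `M₀ - i * N`, `M₀` the largest initial degree
  have key : ∀ i, ∀ β ∈ c.G i, β.deg + i * N ≤ (c.G 0).sup Expo.deg := by
    intro i
    induction i with
    | zero =>
      intro β hβ
      simpa using Finset.le_sup (f := Expo.deg) hβ
    | succ i ih =>
      intro β hβ
      rw [c.step i, Finset.mem_image] at hβ
      obtain ⟨α, hα, rfl⟩ := hβ
      have h1 := ih α hα
      have h2 : (Expo.chart N (c.dir i) α).deg = α.deg - N + (α.deg - α (c.dir i)) := Expo.deg_chart N _ α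
      rw [hdeg1] at h2
      have h3 := c.orderGE i α hα
      rw [h2, add_mul, one_mul]
      omega
  set M := (c.G 0).sup Expo.deg
  obtain ⟨β, hβ⟩ := c.nonempty (M + 1)
  have h1 := key (M + 1) β hβ
  have h2 := c.orderGE (M + 1) β hβ
  have h3 : M + 1 ≤ (M + 1) * N := Nat.le_mul_of_pos_right _ hN
  omega

/-! ### The shadow class: EXACT four-way split and its three decided pieces -/

/-- **EXACT**: the shadow class terminates iff its four hug-type pieces do (excluded middle, thrice). [folklore] -/
theorem shadow_iff_pieces {N : ℕ} :
    ShadowTowersTerminate N ↔ ShadowTransversal N ∧ ShadowCurve N ∧ ShadowContact N ∧ ShadowWild N := by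
  constructor
  · intro h
    exact ⟨noShadowTower_mono (fun _ _ => trivial) h, noShadowTower_mono (fun _ _ => trivial) h,
      noShadowTower_mono (fun _ _ => trivial) h, noShadowTower_mono (fun _ _ => trivial) h⟩
  · rintro ⟨h₁, h₂, h₃, h₄⟩ p hp A _ _ _ hA hd T hT -
    by_cases hG : GermHugging T
    · by_cases hCu : CurveHugging T
      · exact h₂ p hp A hA hd T hT hCu
      · by_cases hCo : ContactHugging T
        · exact h₃ p hp A hA hd T hT ⟨hCo, hCu⟩
        · exact h₄ p hp A hA hd T hT ⟨hG, hCu, hCo⟩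
    · exact h₁ p hp A hA hd T hT hG

/-- The imperfect-residue part of the shadow class from the three decided pieces and the RESIDUAL. [folklore] -/
theorem shadowImp_of_pieces {N : ℕ} (h₁ : ShadowTransversal N) (h₂ : ShadowCurve N) (h₃ : ShadowContact N)
    (h₄ : ShadowWildImp N) : NoShadowTowerImp N fun _ => True := by
  intro p hp A _ _ _ hA hd hK T hT _
  by_cases hG : GermHugging T
  · by_cases hCu : CurveHugging T
    · exact h₂ p hp A hA hd T hT hCu
    · by_cases hCo : ContactHugging T
      · exact h₃ p hp A hA hd T hT ⟨hCo, hCu⟩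
      · exact h₄ p hp A hA hd hK T hT ⟨hG, hCu, hCo⟩
  · exact h₁ p hp A hA hd T hT hG

/-- The whole shadow class from its four pieces (all residue fields). [folklore] -/
theorem shadow_of_pieces {N : ℕ} (h₁ : ShadowTransversal N) (h₂ : ShadowCurve N) (h₃ : ShadowContact N)
    (h₄ : ShadowWild N) : ShadowTowersTerminate N :=
  shadow_iff_pieces.mpr ⟨h₁, h₂, h₃, h₄⟩

/-- The `≥ N` combinatorial leaf from the two bookkeeping ports. [folklore] -/
theorem noCornerTowerGE_of_model (hM : CornerModelGE) (hT : TowerObstructsAll) :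
    ∀ d N : ℕ, d ≤ 4 → 1 ≤ N → NoCornerTowerGE d N := by
  intro d N hd hN c
  obtain ⟨p, hp, k, _, _, T, g, hB, t, ht⟩ := hM d N hd hN c
  exact hT p hp k T g hB ⟨t, ht⟩

/-- **The transversal shadow piece is DECIDED modulo (ShT) and the combinatorial leaf.** [folklore] -/
theorem shadowTransversal_of_ports {N : ℕ} (hF : CornerNormalFormSh N) (hC : ∀ d : ℕ, d ≤ 3 → NoCornerTowerGE d N) :
    ShadowTransversal N := by
  intro p hp A _ _ _ hA hd T hT hG
  obtain ⟨d, hd3, ⟨c⟩⟩ := hF p hp A hA hd T hT hG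
  exact hC d hd3 c

/-- The transversal shadow piece from the three ports. [folklore] -/
theorem shadowTransversal_of_model {N : ℕ} (hN : 1 ≤ N) (hF : CornerNormalFormSh N) (hM : CornerModelGE)
    (hT : TowerObstructsAll) : ShadowTransversal N :=
  shadowTransversal_of_ports hF fun d hd => noCornerTowerGE_of_model hM hT d N (by omega) hN

/-- **The curve shadow piece is DECIDED modulo (ShC)** (the descent is done here). [folklore] -/
theorem shadowCurve_of_law {N : ℕ} (hL : CurveLawSh N) : ShadowCurve N := by
  intro p hp A _ _ _ hA hd T hT hCu
  obtain ⟨δ, μ, hδ, hlow, hstep⟩ := hL p hp A hA hd T hT hCu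
  exact noInfiniteDescent hδ hlow hstep

/-- **The order-one shadow piece is DECIDED modulo (ShS)** (the corner descent is done here). [folklore] -/
theorem shadowContact_of_law {N : ℕ} (hL : SurfaceLawSh N) : ShadowContact N := by
  intro p hp A _ _ _ hA hd T hT hC
  obtain ⟨N', a, b, -, hab, hstep⟩ := hL p hp A hA hd T hT hC.1 hC.2
  exact SurfaceShadowKernels.noCornerDescent hab hstep

/-! ### The columns from the formal shadow -/

/-- ALL fields: 31571 at marking `n` from the formal shadow and the whole shadow class at marking `n!`. [folklore] -/
theorem contact_of_formal {n : ℕ} (hF : FormalContactShadow n) (hS : ShadowTowersTerminate n.factorial) :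
    ContactHuggingTowersTerminate n := by
  intro p hp k _ _ T g hB hD hE hC
  obtain ⟨A, _, _, _, hA, hd, -, T', hT'⟩ := hF p hp k T g hB hD hE hC
  exact hS p hp A hA hd T' hT' trivial

/-- **THE IMPERFECT COLUMN IS LOCATED**: it follows from the formal shadow and the IMPERFECT-RESIDUE part of the shadow
class (residue transfer `PerfectField κ(pt m) → PerfectField k`). [folklore] -/
theorem contactImperfect_of_formal {n : ℕ} (hF : FormalContactShadow n)
    (hS : NoShadowTowerImp n.factorial fun _ => True) : ContactImperfect n := by
  intro p hp k _ _ hk T g hB hD hE hC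
  obtain ⟨A, _, _, _, hA, hd, hres, T', hT'⟩ := hF p hp k T g hB hD hE hC
  exact hS p hp A hA hd (fun hK => hk (hres hK)) T' hT' trivial

/-- The imperfect column from the ports and the RESIDUAL `ShadowWildImp n!`. [folklore] -/
theorem contactImperfect_of_ports {n : ℕ} (hF : FormalContactShadow n)
    (hCN : CornerNormalFormSh n.factorial) (hCM : CornerModelGE) (hT : TowerObstructsAll)
    (hCL : CurveLawSh n.factorial) (hSL : SurfaceLawSh n.factorial) (hW : ShadowWildImp n.factorial) :
    ContactImperfect n :=
  contactImperfect_of_formal hF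
    (shadowImp_of_pieces (shadowTransversal_of_model (Nat.succ_le_of_lt n.factorial_pos) hCN hCM hT)
      (shadowCurve_of_law hCL) (shadowContact_of_law hSL) hW)

/-- **EXACT**: 31571 at marking `n` ⟺ its two columns. [folklore] -/
theorem contact_iff_columns {n : ℕ} : ContactHuggingTowersTerminate n ↔ ContactPerfect n ∧ ContactImperfect n :=
  noTower_iff_columns ContactHugging

/-! ### Sanity: the tree's counting port is the `IsDatum` slice of `TowerObstructsAll` -/

/-- `TowerObstructsAll` refines the tree's `TowerObstructs n` for every `n`. [folklore] -/
theorem towerObstructs_of_all (h : TowerObstructsAll) (n : ℕ) : TowerObstructs n :=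
  fun p hp k _ _ T g hB _ => h p hp k T g hB

/-- With `TowerObstructsAll` the tree's combinatorial leaf also follows from `CornerModelGE` (order `≥ n` ⊇ order
`= n`). [folklore] -/
theorem noCornerTower_of_modelGE (hM : CornerModelGE) (hT : TowerObstructsAll) :
    ∀ n : ℕ, 1 ≤ n → ∀ d : ℕ, d ≤ 4 → NoCornerTower d n :=
  fun n hn d hd => noCornerTower_of_ge (noCornerTowerGE_of_model hM hT d n hd hn)

end Summit.ResolutionOfSingularities.ResolutionOfSingularities.Theorems.ContactShadowKernels
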